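import Literature.NumberTheory.Sieve.GoldbachLinnikRomanovCertTop
import Literature.NumberTheory.Sieve.TwinPrimeConstUpperBound
import HarnessLib

/-!
# Romanov's constant: the kernel LOWER bound `R₀ ≥ 1.93665` (read off the E16 certificate), and four printed bounds refuted

Topic `Literature/NumberTheory/Sieve`; sequel to `GoldbachLinnikRomanovCertTop.lean` (`romanovConst ≤ 1.94`, the 18-module
kernel certificate "E16" of cell `pub-lg7`, seat 2).  Written by the cell's LITERATURE seat (seat 4).
**NOT A ROUTE TO GOLDBACH; `K = 7` is NOT claimed (the print record is `K = 8`, Pintz–Ruzsa 2020); `K = 6` is NOT obtained;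
nothing in-house is cited as fact.**

`R₀ = romanovConst = ∑′_{t odd square-free} f₁(t)/ord_t 2` (`f₁(t) = ∏_{p ∣ t} (p − 2)⁻¹`; Pintz–Ruzsa I (8.13); Heath-Brown–Puchta's
`C₂`, Platt–Trudgian's `C₂`).  PRINT: `1.936 < R₀ < 1.94` [PintzRuzsa2003, (8.14)] = [KhalfalahPintz2006, Cor. 1] ("one can show by
calculations").  Before this file the tree proved the UPPER half three times over (`romanovConst_le_1958`, `R0Cert.romanovConst_le_1944`,
`romanovConst_le_194`) and NO lower bound beyond `romanovConst_nonneg`.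

## What is proved, and how (no new kernel computation)

* `GoldbachLinnik.romanovConst_ge_193665 : 1.93665 ≤ romanovConst` and the nine-digit
  `GoldbachLinnik.romanovConst_ge_sharp : 1.93665067 ≤ romanovConst`;
* hence the two-sided kernel window `GoldbachLinnik.romanovConst_window : 1.93665 ≤ R₀ ∧ R₀ ≤ 1.94` — BOTH halves of the printed
  (8.14) are now theorems of the tree (the lower half sharpened from `1.936`);
* the refutations `GoldbachLinnik.not_romanovConst_lt_193656`, `GoldbachLinnik.not_romanovConst_le_193657` of four PRINTED upper
  bounds (list below);
* (§5, one small kernel computation, ≈ 30 s) `GoldbachLinnik.twinPrimeConst_ge_0660135 : 0.660135 ≤ twinPrimeConst` (fixed-point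
  product over the 2546 odd primes `≤ 22800`, trial division complete on primes; the tree had `0.65828 ≤ C₀ ≤ 0.660166`), whence
  the PRODUCT form of the refutation, `GoldbachLinnik.not_twinPrimeConst_mul_romanovConst_lt : ¬ C₀R₀ < 1.2784421041`, and the
  kernel window `GoldbachLinnik.twinPrimeConst_mul_romanovConst_window : 1.27845 ≤ C₀R₀ ≤ 1.2808` (print: `1.27835 < 1 + A(1) <
  1.2792521041` [KhalfalahPintz2006, Thm 2], consistent).

The proof reads the SAME kernel tuple `RomanovCert.head_total : headSums recs 1 (2^15 − 1) = (T⁺, T⁻, I, S⁺, S⁻, true)` that gave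
`R₀ ≤ 1.94`, in the opposite direction:
1. (§1) for any finite family `T` of finite sets `S` of odd primes, `Σ_{S ∈ T} w(S)/Lo(S) ≤ R₀` (`w(S) = ∏_{p∈S}(p−2)⁻¹`,
   `Lo(S) = lcm_{p ∈ S} ord_p 2`; the map `S ↦ ∏ S` is injective, `f₁(∏ S) = w(S)`, `ord_{∏ S} 2 = Lo(S)`, and every finite partial
   sum of the defining series is `≤ R₀`, `GoldbachLinnik.sum_fq_div_ordTwo_le_romanovConst`);
2. (§2) by the Möbius inversion `RomanovCert.head_moebius` with weight `ω(n) = 1/n`, the head quantity of the certificate is such a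
   partial sum: `Σ_{d<2^15} H_F(d)·m(x_d)/d = Σ_{S ⊆ C, Lo S < 2^15} w(S)/Lo(S)`, `C` = the 16677 listed primes (all `q ≤ 4 599 989`
   with `ord_q 2 < 2^15`, kernel-certified by `RomanovCert.certAll_recs`), `H_F(d) = ∏_{q ∈ C, ord_q 2 ∣ d}(1 + (q−2)⁻¹)`,
   `m(y) = Σ_{k≤y} μ(k)/k`, `x_d = ⌊(2^15−1)/d⌋`;
3. (§3) the kernel integers are directed ROUNDINGS of these reals: `⌈a/b⌉ ≤ a/b + 1`, `⌊a/b⌋ ≥ a/b − 1`, so the upper-rounded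
   `T⁺ = Σ_d ⌈Hn_d·Σ⁺_{g≤x_d}⌈2^60/g⌉/(Hd_d·d)⌉` and the lower-rounded `T⁻`, `S⁺` ALSO bound the head from BELOW:
   `Σ_d H_F(d) m(x_d)/d ≥ (T⁺ − T⁻ − 2(2^15−1))/2^60 − (S⁺ + (2^15−1) + S⁻)/2^120` (`head_ge`: one unit rounding per `d` in
   each of `T⁺`, `T⁻`, `S⁺`; the `S⁺`-term absorbs the `#{μ = 1}` unit roundings, since
   `H_F(d)·#{g ≤ x_d : μ(g)=1}/d ≤ H_F(d)·#{…} ≤ (s⁺_d + 1)/2^60`);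
4. (§4) `norm_num`: that rational is `≥ 1.93665067` (it equals `1.93665067042017…`; the upper head `(T⁺−T⁻)/2^60 = 1.9366506704206…`).
Numerically this is the order-truncated partial sum of the series over the listed primes (`1.936650670421`, the value the cell's two
independent floating/interval implementations give for the same quantity) — now a theorem; the cell's larger numerical partial sum
over `t ≤ 10⁸` (`1.93666…`) is NOT claimed here.

## Printed statements REFUTED by `romanovConst_ge_193665` (verbatim; `C₂`/`R₀` there = `romanovConst` here, the same series)

* Platt–Trudgian, J. Number Theory 153 (2015) 54–62, §1 p. 55 (arXiv:1404.5669, TeX l. 64): "Lemma 2″ of [PintzRom] shows that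
  `1.2783521041 < C₂C₀ < 1.2784421041`, which may be combined with (C0bound) to give `1.93642 < C₂ < 1.93656`." — the conclusion
  `C₂ < 1.93656` is FALSE (`not_romanovConst_lt_193656`).  [PlattTrudgian2015Linnik]
* Johnston–Trudgian, arXiv:2605.17825v2 (22 Jul 2026), display (R0bounds): "`1.93642 < R_0 < 1.93656`" (quoting Platt–Trudgian) — FALSE
  upper half (idem).  [JohnstonTrudgian2026]
* Lü–Sun, Proc. Amer. Math. Soc. 137 (2009) 1185–1191, proof of Lemma 2.4 (p. 7 of the held text): "By Lemma 2 of [17], we can replace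
  (41) of [3] by `C₂ ≤ 1.93657`" ([17] = Pintz 2006, [3] = Heath-Brown–Puchta 2002, (41): `C₂ ≤ 2.2141`) — FALSE
  (`not_romanovConst_le_193657`).  [LuSun2009]
* Liu–Lü, J. Number Theory 131 (2011) 716–736, proof of Lemma 2.3 (p. 7 l. 5 of the held text): the identical sentence with "[27]" = Pintz
  2006 — FALSE (idem).  [LiuLu2011JNT]
All four trace to J. Pintz, *A note on Romanov's constant*, Acta Math. Hungar. 112 (2006) 1–14, Lemma 2″ (NOT held by the cell,
acq-07716; its inequality `C₀R₀ < 1.2784421041` is what Platt–Trudgian quote, and it is exactly the input that reproduces Pintz's own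
threshold `C₁′ ≤ 2.603226`, `pintz_Ktwo_threshold_asPrinted` in `RomanovConstantLowerBounds`): that product inequality is refuted by
`not_twinPrimeConst_mul_romanovConst_lt` (§5: `C₀R₀ ≥ 0.660135 · 1.93665067 > 1.27845`); the printed `K`-values of these papers are unaffected
(every integer conclusion there survives the correction `1.93656 → 1.94`, cf. `plattTrudgian_criterion_twelve`, `liuLu_criterion_twelve` in `GoldbachLinnikHBPCriterion`).  The refereed CONSISTENT window is [KhalfalahPintz2006, Thm 2]
(`k = 1`) as quoted by Languasco–Zaccagnini 2010 Lemma 1: `A(1) = C₀R₀ − 1 < 0.2792521041`, i.e. `R₀ < 1.93779`.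

## References

* J. Pintz, I. Z. Ruzsa, *On Linnik's approximation to Goldbach's problem, I*, Acta Arith. 109 (2003) 169–194: (8.13)–(8.14). [PintzRuzsa2003]
* A. Khalfalah, J. Pintz, *On the representation of Goldbach numbers by a bounded number of powers of two*, Schr. Wiss. Ges. J. W. Goethe
  Univ. Frankfurt 20 (2006) 129–142: Corollary 1 (`1.936 < R₀ < 1.94`). [KhalfalahPintz2006]
* D. R. Heath-Brown, J.-C. Puchta, *Integers represented as a sum of primes and powers of two*, Asian J. Math. 6 (2002) 535–565: §5 (41). [HeathbrownPuchta2002]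
* D. Platt, T. Trudgian, *Linnik's approximation to Goldbach's conjecture, and other problems*, J. Number Theory 153 (2015) 54–62: p. 55. [PlattTrudgian2015Linnik]
* D. R. Johnston, T. Trudgian, *An update on the Linnik–Goldbach problem*, arXiv:2605.17825v2 (2026): (R0bounds). [JohnstonTrudgian2026]
* G. Lü, H. Sun, Proc. Amer. Math. Soc. 137 (2009) 1185–1191: Lemma 2.4. [LuSun2009]
* Z. Liu, G. Lü, J. Number Theory 131 (2011) 716–736: Lemma 2.3. [LiuLu2011JNT]
* J. Pintz, *A note on Romanov's constant*, Acta Math. Hungar. 112 (2006) 1–14: Lemma 2″ (unheld; quoted via the four above). [Pintz2006]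
-/

open Finset

namespace Literature.NumberTheory.Sieve.RomanovCert

open Literature.NumberTheory.Sieve.Romanov GoldbachLinnik SingularSeriesMean

/-! ## §1 Partial sums of `R₀` over the square-free products of sets of odd primes -/

/-- For a finite set `S` of odd primes, `∏ S` has prime-factor set `S`, is square-free and is odd (coprime to `2`). [folklore] -/
theorem prod_primeSet_spec {S : Finset ℕ} (hS : PrimeSet S) :
    (∏ p ∈ S, p).primeFactors = S ∧ Squarefree (∏ p ∈ S, p) ∧ Nat.Coprime (∏ p ∈ S, p) 2 := by
  refine ⟨Nat.primeFactors_prod fun p hp => (hS p hp).1, ?_, ?_⟩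
  · have hpw : Set.Pairwise (↑S : Set ℕ) (Function.onFun IsRelPrime fun p : ℕ => p) := by
      intro p hp q hq hpq
      simp only [Function.onFun]
      exact Nat.coprime_iff_isRelPrime.1 ((Nat.coprime_primes (hS p hp).1 (hS q hq).1).2 hpq)
    exact Finset.squarefree_prod_of_pairwise_isCoprime hpw fun p hp => (hS p hp).1.prime.squarefree
  · exact Nat.Coprime.prod_left fun p hp =>
      (Nat.coprime_primes (hS p hp).1 Nat.prime_two).2 (by have := (hS p hp).2; omega)

/-- `f₁(∏ S) = w(S) = ∏_{p ∈ S} (p − 2)⁻¹` for a finite set `S` of odd primes. [folklore] -/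
theorem fq_one_prod_primeSet {S : Finset ℕ} (hS : PrimeSet S) : fq 1 (∏ p ∈ S, p) = wt S := by
  obtain ⟨hpf, hsq, hcop⟩ := prod_primeSet_spec hS
  have hcop' : Nat.Coprime (∏ p ∈ S, p) (2 * 1) := by rw [mul_one]; exact hcop
  rw [fq_apply, if_pos ⟨hsq, hcop'⟩, hpf]
  rfl

/-- `ord_{∏ S} 2 = Lo(S) = lcm_{p ∈ S} ord_p 2` for a finite set `S` of odd primes. [folklore] -/
theorem ordTwo_prod_primeSet {S : Finset ℕ} (hS : PrimeSet S) : ordTwo (∏ p ∈ S, p) = Lo S := by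
  apply Nat.dvd_antisymm
  · rw [← dvd_two_pow_sub_one_iff]
    refine Finset.prod_primes_dvd _ (fun p hp => (hS p hp).1.prime) fun p hp => ?_
    rw [dvd_two_pow_sub_one_iff]
    exact Finset.dvd_lcm hp
  · exact Finset.lcm_dvd fun p hp => ordTwo_dvd_ordTwo_of_dvd (Finset.dvd_prod_of_mem _ hp)

/-- **Partial sums over square-free products of odd primes are `≤ R₀`.**  For any finite family `T` of finite sets of odd
primes, `Σ_{S ∈ T} w(S)/Lo(S) ≤ R₀` (`S ↦ ∏ S` is injective on such sets, `f₁(∏ S) = w(S)`, `ord(∏ S) = Lo(S)`, and every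
finite partial sum of `R₀ = Σ′ f₁(t)/ord_t 2` is at most `R₀`). [cite: PintzRuzsa2003, (8.13)] -/
theorem sum_wt_div_Lo_le_romanovConst (T : Finset (Finset ℕ)) (hT : ∀ S ∈ T, PrimeSet S) :
    ∑ S ∈ T, wt S / (Lo S : ℝ) ≤ romanovConst := by
  classical
  have hinj : Set.InjOn (fun S : Finset ℕ => ∏ p ∈ S, p) ↑T := by
    intro S hS S' hS' h
    have h' : (∏ p ∈ S, p).primeFactors = (∏ p ∈ S', p).primeFactors := by
      simp only at h
      rw [h]
    rwa [(prod_primeSet_spec (hT S hS)).1, (prod_primeSet_spec (hT S' hS')).1] at h'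
  calc ∑ S ∈ T, wt S / (Lo S : ℝ)
      = ∑ S ∈ T, fq 1 (∏ p ∈ S, p) / (ordTwo (∏ p ∈ S, p) : ℝ) := by
        refine Finset.sum_congr rfl fun S hS => ?_
        rw [fq_one_prod_primeSet (hT S hS), ordTwo_prod_primeSet (hT S hS)]
    _ = ∑ t ∈ T.image (fun S => ∏ p ∈ S, p), fq 1 t / (ordTwo t : ℝ) := by
        rw [Finset.sum_image hinj]
    _ ≤ romanovConst := sum_fq_div_ordTwo_le_romanovConst _

/-! ## §2 The head of the E16 certificate is such a partial sum -/

/-- **The head of the certificate as a partial sum of `R₀`'s series** (Möbius inversion `head_moebius` with `ω(n) = 1/n`):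
`Σ_{d=1}^{2^15−1} H_F(d)·m(x_d)/d = Σ_{S ⊆ C, Lo S ≤ 2^15−1} w(S)/Lo(S)`, `C` the listed primes. [folklore] -/
theorem head_eq_partialSum {recs : List (ℕ × List ℕ)} (hcert : certAll recs = true) :
    ∑ d ∈ Finset.Icc 1 (MM - 1), HF recs d * mFun (xOf d) / d =
      ∑ S ∈ (CsetT recs).powerset with Lo S ≤ MM - 1, wt S / (Lo S : ℝ) := by
  have hC := primeSet_CsetT hcert
  have h := head_moebius hC (fun n => 1 / (n : ℝ)) (MM - 1)
  beta_reduce at h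
  have hR : ∑ S ∈ (CsetT recs).powerset with Lo S ≤ MM - 1, wt S / (Lo S : ℝ) =
      ∑ S ∈ (CsetT recs).powerset with Lo S ≤ MM - 1, wt S * (1 / ((Lo S : ℕ) : ℝ)) :=
    Finset.sum_congr rfl fun S _ => by ring
  rw [hR, ← h]
  refine Finset.sum_congr rfl fun d hd => ?_
  obtain ⟨hd1, hdN⟩ := Finset.mem_Icc.1 hd
  have hd' : d < 32768 := by unfold MM at hdN; omega
  have hinner : ∑ k ∈ Finset.Icc 1 (xOf d), (ArithmeticFunction.moebius k : ℝ) * (1 / ((k * d : ℕ) : ℝ)) =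
      (∑ k ∈ Finset.Icc 1 (xOf d), (ArithmeticFunction.moebius k : ℝ) / k) / d := by
    rw [Finset.sum_div]
    refine Finset.sum_congr rfl fun k _ => ?_
    push_cast
    ring
  rw [← HF_eq_filter hcert hd1 hd', show (MM - 1) / d = xOf d from rfl, hinner, mFun]
  ring

/-! ## §3 Lower roundings read off the same kernel integers -/

/-- `⌈a/b⌉ ≤ a/b + 1` in `ℝ` (`cdiv a b = ⌊(a + b − 1)/b⌋`). [folklore] -/
theorem cast_cdiv_le_add_one (a : ℕ) {b : ℕ} (hb : 0 < b) :
    ((cdiv a b : ℕ) : ℝ) ≤ (a : ℝ) / b + 1 := by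
  unfold cdiv
  have hb' : (0 : ℝ) < b := by exact_mod_cast hb
  have h1 : ((Nat.div (a + b - 1) b : ℕ) : ℝ) ≤ ((a + b - 1 : ℕ) : ℝ) / b := Nat.cast_div_le
  have h2 : ((a + b - 1 : ℕ) : ℝ) ≤ (a : ℝ) + b := by
    have : a + b - 1 ≤ a + b := Nat.sub_le _ _
    exact_mod_cast this
  calc ((Nat.div (a + b - 1) b : ℕ) : ℝ) ≤ ((a + b - 1 : ℕ) : ℝ) / b := h1
    _ ≤ ((a : ℝ) + b) / b := div_le_div_of_nonneg_right h2 hb'.le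
    _ = (a : ℝ) / b + 1 := by rw [add_div, div_self hb'.ne']

/-- `a/b − 1 ≤ ⌊a/b⌋` in `ℝ`. [folklore] -/
theorem cast_div_sub_one_le (a : ℕ) {b : ℕ} (hb : 0 < b) :
    (a : ℝ) / b - 1 ≤ ((Nat.div a b : ℕ) : ℝ) := by
  have hb' : (0 : ℝ) < b := by exact_mod_cast hb
  have h := Nat.lt_div_mul_add (a := a) hb
  have h' : (a : ℝ) < ((a / b : ℕ) : ℝ) * b + b := by exact_mod_cast h
  rw [sub_le_iff_le_add, div_le_iff₀ hb']
  show (a : ℝ) ≤ (((Nat.div a b : ℕ) : ℝ) + 1) * b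
  have : ((Nat.div a b : ℕ) : ℝ) = ((a / b : ℕ) : ℝ) := rfl
  rw [this]
  linarith

/-- **`m(y)` from the kernel sums, from BELOW**:
`(Σ⁺⌈2^K/g⌉ − #{g ≤ y : μ(g) = 1} − Σ⁻⌊2^K/g⌋ − #{g ≤ y : μ(g) = −1})/2^K ≤ m(y)`
(`⌈2^K/g⌉ ≤ 2^K/g + 1` on the `μ = 1` terms, `⌊2^K/g⌋ ≥ 2^K/g − 1` on the `μ = −1` terms). [folklore] -/
theorem mFun_ge {y : ℕ} (hy : y < 33124) :
    ((((muData y).1 : ℕ) : ℝ) - (((muData y).2.2.1 : ℕ) : ℝ) - (((muData y).2.1 : ℕ) : ℝ) -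
        (((muData y).2.2.2 : ℕ) : ℝ)) / 2 ^ KK ≤ mFun y := by
  have hsc : (0 : ℝ) < 2 ^ KK := by positivity
  induction y with
  | zero => simp [mFun, muData_zero]
  | succ y ih =>
    have ih' := ih (by omega)
    -- the new term, multiplied through by `2^K`
    have hstep : (((if tagOf (y + 1) = 1 then cdiv (Nat.pow 2 KK) (y + 1) else 0 : ℕ) : ℝ) -
          ((if tagOf (y + 1) = 1 then 1 else 0 : ℕ) : ℝ) -
          ((if tagOf (y + 1) = 2 then Nat.div (Nat.pow 2 KK) (y + 1) else 0 : ℕ) : ℝ) -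
          ((if tagOf (y + 1) = 2 then 1 else 0 : ℕ) : ℝ)) ≤
        2 ^ KK * ((ArithmeticFunction.moebius (y + 1) : ℝ) / (y + 1 : ℕ)) := by
      have hmu := moebius_eq_tagVal_facSm (g := y + 1) (by omega) (by omega)
      have hmuR : (ArithmeticFunction.moebius (y + 1) : ℝ) = ((tagVal (tagOf (y + 1)) : ℤ) : ℝ) := by
        rw [tagOf, ← hmu]
      rw [hmuR]
      have hy0 : (0 : ℝ) < ((y + 1 : ℕ) : ℝ) := by positivity
      have hc : ((cdiv (Nat.pow 2 KK) (y + 1) : ℕ) : ℝ) ≤ 2 ^ KK / ((y + 1 : ℕ) : ℝ) + 1 := by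
        have := cast_cdiv_le_add_one (Nat.pow 2 KK) (b := y + 1) (by omega)
        rw [cast_sc] at this
        exact this
      have hdn : 2 ^ KK / ((y + 1 : ℕ) : ℝ) - 1 ≤ ((Nat.div (Nat.pow 2 KK) (y + 1) : ℕ) : ℝ) := by
        have := cast_div_sub_one_le (Nat.pow 2 KK) (b := y + 1) (by omega)
        rw [cast_sc] at this
        exact this
      have e1 : (2 : ℝ) ^ KK * ((1 : ℝ) / ((y + 1 : ℕ) : ℝ)) = 2 ^ KK / ((y + 1 : ℕ) : ℝ) := by ring
      have e2 : (2 : ℝ) ^ KK * ((-1 : ℝ) / ((y + 1 : ℕ) : ℝ)) = -(2 ^ KK / ((y + 1 : ℕ) : ℝ)) := by ring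
      rcases htag : tagOf (y + 1) with _ | _ | _ | k
      · simp [tagVal]
      · simp only [tagVal, if_true, show (1 : ℕ) ≠ 2 by decide, if_false, Int.cast_one, Nat.cast_zero,
          Nat.cast_one, sub_zero, e1]
        linarith
      · simp only [tagVal, show (2 : ℕ) ≠ 1 by decide, if_false, if_true, Int.cast_neg, Int.cast_one,
          Nat.cast_zero, Nat.cast_one, sub_zero, zero_sub, e2]
        linarith
      · simp [tagVal_add_three]
    rw [mFun, Finset.sum_Icc_succ_top (by omega), muData_succ]
    rw [mFun] at ih'
    rw [div_le_iff₀ hsc] at ih' ⊢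
    push_cast at ih' hstep ⊢
    rw [add_mul]
    linarith [ih', hstep]

/-- **The `T`-term from BELOW**: `((t⁺_d − t⁻_d − 2) − (s⁺_d + 1 + s⁻_d)/2^K)/2^K ≤ H_F(d)·m(x_d)/d`, where
`t⁺_d, t⁻_d, s⁺_d, s⁻_d` are the per-`d` increments of the kernel accumulators `T⁺, T⁻, S⁺, S⁻` (`incr`):
`⌈a⌉ − 1 ≤ a`, `⌊b⌋ + 1 ≥ b`, and `H_F(d)(#{μ=1} + #{μ=−1})/d ≤ H_F(d)(#{μ=1} + #{μ=−1}) ≤ (s⁺_d + 1 + s⁻_d)/2^K`. [folklore] -/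
theorem termT_ge {recs : List (ℕ × List ℕ)} (h : certAll recs = true) {d : ℕ} (hd0 : 0 < d)
    (hd : d < 32768) :
    (((((incr (mkTree recs) d).1 : ℕ) : ℝ) - (((incr (mkTree recs) d).2.1 : ℕ) : ℝ) - 2) -
        ((((incr (mkTree recs) d).2.2.2.1 : ℕ) : ℝ) + 1 + (((incr (mkTree recs) d).2.2.2.2 : ℕ) : ℝ)) / 2 ^ KK) /
        2 ^ KK ≤
      HF recs d * mFun (xOf d) / d := by
  obtain ⟨hHF, hpos⟩ := HF_eq_dData h hd0 hd
  set v := dData (mkTree recs) d with hv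
  set mu := muData (xOf d) with hmu
  have hx : xOf d < 33124 := by
    unfold xOf MM; exact lt_of_le_of_lt (Nat.div_le_self _ _) (by norm_num)
  have hm := mFun_ge hx
  have hsc : (0 : ℝ) < 2 ^ KK := by positivity
  have hHd : (0 : ℝ) < ((v.2.2 : ℕ) : ℝ) := by exact_mod_cast hpos
  have hdR : (0 : ℝ) < (d : ℝ) := by exact_mod_cast hd0
  have hd1 : (1 : ℝ) ≤ (d : ℝ) := by exact_mod_cast hd0
  have hHn : (0 : ℝ) ≤ ((v.2.1 : ℕ) : ℝ) := Nat.cast_nonneg _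
  have hp1 : (0 : ℝ) ≤ ((mu.2.2.1 : ℕ) : ℝ) := Nat.cast_nonneg _
  have hn1 : (0 : ℝ) ≤ ((mu.2.2.2 : ℕ) : ℝ) := Nat.cast_nonneg _
  have h1 : (incr (mkTree recs) d).1 = cdiv (v.2.1 * mu.1) (v.2.2 * d) := rfl
  have h2 : (incr (mkTree recs) d).2.1 = Nat.div (v.2.1 * mu.2.1) (v.2.2 * d) := rfl
  have h4 : (incr (mkTree recs) d).2.2.2.1 = Nat.div (v.2.1 * mu.2.2.1 * Nat.pow 2 KK) v.2.2 := rfl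
  have h5 : (incr (mkTree recs) d).2.2.2.2 = cdiv (v.2.1 * mu.2.2.2 * Nat.pow 2 KK) v.2.2 := rfl
  rw [h1, h2, h4, h5, hHF]
  -- the four roundings
  have hA : ((cdiv (v.2.1 * mu.1) (v.2.2 * d) : ℕ) : ℝ) ≤
      ((v.2.1 : ℕ) : ℝ) * ((mu.1 : ℕ) : ℝ) / (((v.2.2 : ℕ) : ℝ) * d) + 1 := by
    have := cast_cdiv_le_add_one (v.2.1 * mu.1) (b := v.2.2 * d) (Nat.mul_pos hpos hd0)
    push_cast at this
    exact this
  have hB : ((v.2.1 : ℕ) : ℝ) * ((mu.2.1 : ℕ) : ℝ) / (((v.2.2 : ℕ) : ℝ) * d) - 1 ≤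
      ((Nat.div (v.2.1 * mu.2.1) (v.2.2 * d) : ℕ) : ℝ) := by
    have := cast_div_sub_one_le (v.2.1 * mu.2.1) (b := v.2.2 * d) (Nat.mul_pos hpos hd0)
    push_cast at this
    exact this
  have hD4 : ((v.2.1 : ℕ) : ℝ) * ((mu.2.2.1 : ℕ) : ℝ) * 2 ^ KK / ((v.2.2 : ℕ) : ℝ) - 1 ≤
      ((Nat.div (v.2.1 * mu.2.2.1 * Nat.pow 2 KK) v.2.2 : ℕ) : ℝ) := by
    have := cast_div_sub_one_le (v.2.1 * mu.2.2.1 * Nat.pow 2 KK) hpos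
    push_cast at this
    try rw [cast_sc] at this
    exact this
  have hD5 : ((v.2.1 : ℕ) : ℝ) * ((mu.2.2.2 : ℕ) : ℝ) * 2 ^ KK / ((v.2.2 : ℕ) : ℝ) ≤
      ((cdiv (v.2.1 * mu.2.2.2 * Nat.pow 2 KK) v.2.2 : ℕ) : ℝ) := by
    have := cast_div_le_cdiv (v.2.1 * mu.2.2.2 * Nat.pow 2 KK) hpos
    push_cast at this
    try rw [cast_sc] at this
    exact this
  -- `H_F · (#{μ=1} + #{μ=−1})/d ≤ H_F · (#{μ=1} + #{μ=−1}) ≤ (s⁺_d + 1 + s⁻_d)/2^K`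
  have hP : ((v.2.1 : ℕ) : ℝ) * (((mu.2.2.1 : ℕ) : ℝ) + ((mu.2.2.2 : ℕ) : ℝ)) / (((v.2.2 : ℕ) : ℝ) * d) ≤
      (((Nat.div (v.2.1 * mu.2.2.1 * Nat.pow 2 KK) v.2.2 : ℕ) : ℝ) + 1 +
        ((cdiv (v.2.1 * mu.2.2.2 * Nat.pow 2 KK) v.2.2 : ℕ) : ℝ)) / 2 ^ KK := by
    have hq0 : 0 ≤ ((v.2.1 : ℕ) : ℝ) * (((mu.2.2.1 : ℕ) : ℝ) + ((mu.2.2.2 : ℕ) : ℝ)) / ((v.2.2 : ℕ) : ℝ) := by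
      positivity
    have hstep1 : ((v.2.1 : ℕ) : ℝ) * (((mu.2.2.1 : ℕ) : ℝ) + ((mu.2.2.2 : ℕ) : ℝ)) / (((v.2.2 : ℕ) : ℝ) * d) ≤
        ((v.2.1 : ℕ) : ℝ) * (((mu.2.2.1 : ℕ) : ℝ) + ((mu.2.2.2 : ℕ) : ℝ)) / ((v.2.2 : ℕ) : ℝ) := by
      rw [← div_div]
      exact div_le_self hq0 hd1
    have hstep2 : ((v.2.1 : ℕ) : ℝ) * (((mu.2.2.1 : ℕ) : ℝ) + ((mu.2.2.2 : ℕ) : ℝ)) / ((v.2.2 : ℕ) : ℝ) ≤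
        (((Nat.div (v.2.1 * mu.2.2.1 * Nat.pow 2 KK) v.2.2 : ℕ) : ℝ) + 1 +
          ((cdiv (v.2.1 * mu.2.2.2 * Nat.pow 2 KK) v.2.2 : ℕ) : ℝ)) / 2 ^ KK := by
      rw [le_div_iff₀ hsc]
      have e : ((v.2.1 : ℕ) : ℝ) * (((mu.2.2.1 : ℕ) : ℝ) + ((mu.2.2.2 : ℕ) : ℝ)) / ((v.2.2 : ℕ) : ℝ) * 2 ^ KK =
          ((v.2.1 : ℕ) : ℝ) * ((mu.2.2.1 : ℕ) : ℝ) * 2 ^ KK / ((v.2.2 : ℕ) : ℝ) +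
            ((v.2.1 : ℕ) : ℝ) * ((mu.2.2.2 : ℕ) : ℝ) * 2 ^ KK / ((v.2.2 : ℕ) : ℝ) := by ring
      rw [e]
      linarith
    exact hstep1.trans hstep2
  -- `H_F m/d ≥ H_F (mp − p1 − mn − n1)/(2^K d)` and the algebra
  have hHF0 : 0 ≤ ((v.2.1 : ℕ) : ℝ) / ((v.2.2 : ℕ) : ℝ) / d := by positivity
  have key : ((v.2.1 : ℕ) : ℝ) / ((v.2.2 : ℕ) : ℝ) / d *
        (((((mu.1 : ℕ) : ℝ) - ((mu.2.2.1 : ℕ) : ℝ) - ((mu.2.1 : ℕ) : ℝ) - ((mu.2.2.2 : ℕ) : ℝ)) / 2 ^ KK)) ≤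
      ((v.2.1 : ℕ) : ℝ) / ((v.2.2 : ℕ) : ℝ) * mFun (xOf d) / d := by
    calc _ ≤ ((v.2.1 : ℕ) : ℝ) / ((v.2.2 : ℕ) : ℝ) / d * mFun (xOf d) := mul_le_mul_of_nonneg_left hm hHF0
      _ = _ := by ring
  have hv0 : ((v.2.2 : ℕ) : ℝ) ≠ 0 := hHd.ne'
  have hd0' : (d : ℝ) ≠ 0 := hdR.ne'
  have e1 : ((v.2.1 : ℕ) : ℝ) / ((v.2.2 : ℕ) : ℝ) / d *
        (((((mu.1 : ℕ) : ℝ) - ((mu.2.2.1 : ℕ) : ℝ) - ((mu.2.1 : ℕ) : ℝ) - ((mu.2.2.2 : ℕ) : ℝ)) / 2 ^ KK)) =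
      (((v.2.1 : ℕ) : ℝ) * ((mu.1 : ℕ) : ℝ) / (((v.2.2 : ℕ) : ℝ) * d) -
        ((v.2.1 : ℕ) : ℝ) * ((mu.2.1 : ℕ) : ℝ) / (((v.2.2 : ℕ) : ℝ) * d) -
        ((v.2.1 : ℕ) : ℝ) * (((mu.2.2.1 : ℕ) : ℝ) + ((mu.2.2.2 : ℕ) : ℝ)) / (((v.2.2 : ℕ) : ℝ) * d)) / 2 ^ KK := by
    field_simp
    ring
  rw [e1] at key
  refine le_trans ?_ key
  refine div_le_div_of_nonneg_right ?_ hsc.le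
  linarith

/-! ## §4 The head from below, and `R₀ ≥ 1.93665` -/

/-- **Head bound from below**: with the kernel tuple `(T⁺, T⁻, I, S⁺, S⁻, ok)` on `[1, 2^15)` (`N = 2^15 − 1` summands),
`(T⁺ − T⁻ − 2N − (S⁺ + N + S⁻)/2^K)/2^K ≤ Σ_{d ≤ N} H_F(d) m(x_d)/d`. [folklore] -/
theorem head_ge {recs : List (ℕ × List ℕ)} (hcert : certAll recs = true)
    {Tp Tn Ip Sp Sn : ℕ} {ok : Bool} (hhead : headSums recs 1 (MM - 1) = (Tp, Tn, Ip, Sp, Sn, ok)) :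
    (((Tp : ℝ) - (Tn : ℝ) - 2 * ((MM - 1 : ℕ) : ℝ)) -
        ((Sp : ℝ) + ((MM - 1 : ℕ) : ℝ) + (Sn : ℝ)) / 2 ^ KK) / 2 ^ KK ≤
      ∑ d ∈ Finset.Icc 1 (MM - 1), HF recs d * mFun (xOf d) / d := by
  have hs := headSums_eq recs (dlo := 1) (len := MM - 1) one_pos
  rw [hhead] at hs
  have hIco : Finset.Ico 1 (1 + (MM - 1)) = Finset.Icc 1 (MM - 1) := by
    ext d; simp only [Finset.mem_Ico, Finset.mem_Icc, MM]; omega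
  rw [hIco] at hs
  simp only [Prod.mk.injEq] at hs
  obtain ⟨hT, hTn, -, hSp, hSn, -⟩ := hs
  have hsc : (0 : ℝ) < 2 ^ KK := by positivity
  have hterm : ∀ d ∈ Finset.Icc 1 (MM - 1),
      (((((incr (mkTree recs) d).1 : ℕ) : ℝ) - (((incr (mkTree recs) d).2.1 : ℕ) : ℝ) - 2) -
        ((((incr (mkTree recs) d).2.2.2.1 : ℕ) : ℝ) + 1 + (((incr (mkTree recs) d).2.2.2.2 : ℕ) : ℝ)) / 2 ^ KK) /
        2 ^ KK ≤
      HF recs d * mFun (xOf d) / d := by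
    intro d hd
    obtain ⟨hd1, hdN⟩ := Finset.mem_Icc.1 hd
    have hd' : d < 32768 := by unfold MM at hdN; omega
    exact termT_ge hcert hd1 hd'
  refine le_trans (le_of_eq ?_) (Finset.sum_le_sum hterm)
  have hcard : ((Finset.Icc 1 (MM - 1)).card : ℝ) = ((MM - 1 : ℕ) : ℝ) := by
    rw [Nat.card_Icc]; norm_num [MM]
  rw [hT, hTn, hSp, hSn]
  push_cast
  rw [← Finset.sum_div]
  congr 1
  rw [Finset.sum_sub_distrib, Finset.sum_sub_distrib, Finset.sum_sub_distrib, ← Finset.sum_div,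
    Finset.sum_add_distrib, Finset.sum_add_distrib, Finset.sum_const, Finset.sum_const, nsmul_eq_mul, nsmul_eq_mul,
    hcard]
  ring

/-- The final rational inequality: `1.93665067 ≤ (T⁺ − T⁻ − 2·32767 − (S⁺ + 32767 + S⁻)/2^60)/2^60` on the kernel tuple of
`RomanovCert.head_total` (the right-hand side equals `1.93665067042017…`; the upper-rounded head is `(T⁺ − T⁻)/2^60 =
1.93665067042060…`). [folklore] -/
theorem final_num_lower :
    (193665067 : ℝ) / 10 ^ 8 ≤
      ((((49538575189018459529 : ℕ) : ℝ) - ((47305768984179276217 : ℕ) : ℝ) - 2 * ((MM - 1 : ℕ) : ℝ)) -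
        (((246339422258495582753820 : ℕ) : ℝ) + ((MM - 1 : ℕ) : ℝ) + ((246326315600758265887969 : ℕ) : ℝ)) /
          2 ^ KK) / 2 ^ KK := by
  norm_num [MM, KK]

/-- **The certified partial sum**: `1.93665067 ≤ Σ_{S ⊆ C, Lo S < 2^15} w(S)/Lo(S)` for the listed primes `C` of the E16 data
(records certified by `certAll_recs`, head tuple `head_total`). [folklore] -/
theorem partialSum_ge :
    (193665067 : ℝ) / 10 ^ 8 ≤ ∑ S ∈ (CsetT recs).powerset with Lo S ≤ MM - 1, wt S / (Lo S : ℝ) :=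
  calc (193665067 : ℝ) / 10 ^ 8 ≤ _ := final_num_lower
    _ ≤ ∑ d ∈ Finset.Icc 1 (MM - 1), HF recs d * mFun (xOf d) / d := head_ge certAll_recs' head_total
    _ = _ := head_eq_partialSum certAll_recs'

end Literature.NumberTheory.Sieve.RomanovCert

/-! ## §5 A kernel lower bound for the twin prime constant: `C₀ ≥ 0.660135` -/

namespace Literature.NumberTheory.Sieve.TwinPrimeConstLowerCert

/-- Trial division with fuel `f`: `true` iff no `d ∈ [c, c + f)` with `d ≠ n` divides `n`. [folklore] -/
def noSmallDiv : ℕ → ℕ → ℕ → Bool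
  | 0, _, _ => true
  | f + 1, n, c => (!(Nat.beq (Nat.mod n c) 0) || Nat.beq c n) && noSmallDiv f n (c + 1)

/-- The candidate test: `2 < n` and no divisor `d ∈ [2, 150]` of `n` other than `n` itself.  Every prime `> 2` passes;
below `151² = 22801` exactly the primes pass (only completeness on primes is used). [folklore] -/
def cand (n : ℕ) : Bool := Nat.blt 2 n && noSmallDiv 149 n 2

/-- The fixed-point product loop over `m ∈ [n, n + f)`: multiply `T` by `m(m−2)/(m−1)²` rounded DOWN when `cand m`
(`RomanovCert.seqN` forces the accumulator at each step, keeping the kernel evaluation shallow). [folklore] -/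
def loop : ℕ → ℕ → ℕ → ℕ
  | 0, _, T => T
  | f + 1, n, T =>
      let T' := bif cand n then Nat.div (T * (n * (n - 2))) ((n - 1) * (n - 1)) else T
      RomanovCert.seqN T' (loop f (n + 1) T')

/-- `c0Lo x`: a lower fixed-point value (scale `2^64`) of `∏_{3 ≤ m ≤ x, cand m} (1 − (m−1)^{-2})`. [folklore] -/
def c0Lo (x : ℕ) : ℕ := loop (x - 2) 3 (2 ^ 64)

set_option maxHeartbeats 0 in
/-- Kernel evaluation: `c0Lo 22800 ≥ 12177884634887772488` (the loop value is `12177884634888821064 = ⌊0.66016444887·2^64⌋`). [folklore] -/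
theorem c0Lo_22800 : Nat.ble 12177884634887772488 (c0Lo 22800) = true := by
  decide +kernel

/-- Completeness of the trial division on numbers whose only divisor in the range is themselves. [folklore] -/
theorem noSmallDiv_of : ∀ (f n c : ℕ), (∀ d : ℕ, c ≤ d → d < c + f → d ∣ n → d = n) → noSmallDiv f n c = true := by
  intro f
  induction f with
  | zero => intro n c _; rfl
  | succ f ih =>
    intro n c h
    simp only [noSmallDiv, Bool.and_eq_true, Bool.or_eq_true, Bool.not_eq_true']
    refine ⟨?_, ih n (c + 1) fun d hd1 hd2 hd3 => h d (by omega) (by omega) hd3⟩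
    by_cases hc : c ∣ n
    · right
      rw [Nat.beq_eq, h c le_rfl (by omega) hc]
    · left
      have : Nat.mod n c ≠ 0 := fun h0 => hc (Nat.dvd_of_mod_eq_zero h0)
      cases hq : Nat.beq (Nat.mod n c) 0
      · rfl
      · exact absurd (Nat.eq_of_beq_eq_true hq) this

/-- Every odd prime passes the candidate test. [folklore] -/
theorem cand_of_prime {p : ℕ} (hp : p.Prime) (h2 : 2 < p) : cand p = true := by
  rw [cand, Bool.and_eq_true]
  refine ⟨by simpa using h2, noSmallDiv_of 149 p 2 fun d hd1 _ hd3 => ?_⟩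
  rcases (Nat.dvd_prime hp).1 hd3 with h | h
  · omega
  · exact h

/-- The real factor `1 − 1/(m−1)²`. [folklore] -/
noncomputable def fac (m : ℕ) : ℝ := 1 - 1 / ((m : ℝ) - 1) ^ 2

/-- `0 ≤ 1 − 1/(m−1)² ≤ 1` for `m ≥ 3`. [folklore] -/
theorem fac_bounds {m : ℕ} (hm : 3 ≤ m) : 0 ≤ fac m ∧ fac m ≤ 1 := by
  have h3 : (3 : ℝ) ≤ m := by exact_mod_cast hm
  have h4 : (4 : ℝ) ≤ ((m : ℝ) - 1) ^ 2 := by nlinarith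
  have h5 : 0 ≤ 1 / ((m : ℝ) - 1) ^ 2 := by positivity
  have h6 : 1 / ((m : ℝ) - 1) ^ 2 ≤ 1 := by
    rw [div_le_one (by linarith)]; linarith
  exact ⟨by unfold fac; linarith, by unfold fac; linarith⟩

/-- **Soundness of the loop**: `loop f n T ≤ T · ∏_{m ∈ [n, n+f), cand m} (1 − (m−1)^{-2})` for `n ≥ 3`
(each step rounds down; the factors are in `[0, 1]`). [folklore] -/
theorem loop_le : ∀ (f n T : ℕ), 3 ≤ n →
    ((loop f n T : ℕ) : ℝ) ≤ (T : ℝ) * ∏ m ∈ Finset.Ico n (n + f), (if cand m = true then fac m else 1) := by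
  intro f
  induction f with
  | zero => intro n T _; simp [loop]
  | succ f ih =>
    intro n T hn
    rw [show n + (f + 1) = n + 1 + f by omega, Finset.prod_eq_prod_Ico_succ_bot (by omega)]
    simp only [loop, RomanovCert.seqN_eq]
    have hprod0 : 0 ≤ ∏ m ∈ Finset.Ico (n + 1) (n + 1 + f), (if cand m = true then fac m else 1) :=
      Finset.prod_nonneg fun m hm => by
        split_ifs
        · exact (fac_bounds (by have := (Finset.mem_Ico.1 hm).1; omega)).1
        · exact zero_le_one
    cases hc : cand n
    · -- not a candidate: `T` unchanged, factor `1`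
      simp only [cond_false, Bool.false_eq_true, if_false, one_mul]
      exact ih (n + 1) T (by omega)
    · -- candidate: `T' = ⌊T n(n−2)/(n−1)²⌋ ≤ T · fac n`
      simp only [cond_true, if_true]
      set T' := Nat.div (T * (n * (n - 2))) ((n - 1) * (n - 1)) with hT'
      have hn1 : 0 < (n - 1) * (n - 1) := Nat.mul_pos (by omega) (by omega)
      have hT'le : ((T' : ℕ) : ℝ) ≤ (T : ℝ) * fac n := by
        have h1 : ((T' : ℕ) : ℝ) ≤ ((T * (n * (n - 2)) : ℕ) : ℝ) / (((n - 1) * (n - 1) : ℕ) : ℝ) :=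
          Nat.cast_div_le
        have hn2 : (2 : ℕ) ≤ n := by omega
        have hn1' : (1 : ℕ) ≤ n := by omega
        have hnz : ((n : ℝ) - 1) ≠ 0 := by
          have : (3 : ℝ) ≤ n := by exact_mod_cast hn
          linarith
        have e : ((T * (n * (n - 2)) : ℕ) : ℝ) / (((n - 1) * (n - 1) : ℕ) : ℝ) = (T : ℝ) * fac n := by
          push_cast [Nat.cast_sub hn2, Nat.cast_sub hn1']
          unfold fac
          field_simp
          ring
        rw [← e]
        exact h1
      calc ((loop f (n + 1) T' : ℕ) : ℝ)
          ≤ (T' : ℝ) * ∏ m ∈ Finset.Ico (n + 1) (n + 1 + f), (if cand m = true then fac m else 1) :=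
            ih (n + 1) T' (by omega)
        _ ≤ (T : ℝ) * fac n * ∏ m ∈ Finset.Ico (n + 1) (n + 1 + f), (if cand m = true then fac m else 1) :=
            mul_le_mul_of_nonneg_right hT'le hprod0
        _ = _ := by ring

/-- The candidates' product is at most the primes' product: `∏_{3≤m≤x, cand m}(1 − (m−1)^{-2}) ≤ ∏_{2<p≤x}(1 − (p−1)^{-2})`
(the odd primes `≤ x` are candidates; extra factors lie in `[0, 1]`). [folklore] -/
theorem prod_cand_le_partial (x : ℕ) :
    ∏ m ∈ Finset.Ico 3 (x + 1), (if cand m = true then fac m else 1) ≤ twinPrimeConstPartial x := by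
  classical
  rw [← Finset.prod_filter, twinPrimeConstPartial]
  have hsub : (Nat.primesLE x).filter (2 < ·) ⊆ (Finset.Ico 3 (x + 1)).filter (fun m => cand m = true) := by
    intro p hp
    rw [Finset.mem_filter, Nat.primesLE_eq_filter_range, Finset.mem_filter, Finset.mem_range] at hp
    obtain ⟨⟨hpx, hpr⟩, hp2⟩ := hp
    exact Finset.mem_filter.2 ⟨Finset.mem_Ico.2 ⟨by omega, hpx⟩, cand_of_prime hpr hp2⟩
  have hmem : ∀ m ∈ (Finset.Ico 3 (x + 1)).filter (fun m => cand m = true), 3 ≤ m := fun m hm =>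
    (Finset.mem_Ico.1 (Finset.mem_filter.1 hm).1).1
  have hfac : ∀ p ∈ (Nat.primesLE x).filter (2 < ·), (1 - 1 / ((p : ℝ) - 1) ^ 2) = fac p := fun p _ => rfl
  rw [Finset.prod_congr rfl hfac, ← Finset.prod_sdiff hsub]
  refine mul_le_of_le_one_left (Finset.prod_nonneg fun p hp => (fac_bounds (hmem p (hsub hp))).1)
    (Finset.prod_le_one (fun m hm => (fac_bounds (hmem m (Finset.mem_sdiff.1 hm).1)).1)
      fun m hm => (fac_bounds (hmem m (Finset.mem_sdiff.1 hm).1)).2)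

end Literature.NumberTheory.Sieve.TwinPrimeConstLowerCert

namespace Literature.NumberTheory.Sieve.GoldbachLinnik

open RomanovCert

/-- **Romanov's constant is at least `1.93665067`** (nine digits): `1.93665067 ≤ R₀ = Σ′_t f₁(t)/ord_t 2`, by the partial sum
of the defining series over the square-free products `∏ S`, `S ⊆` {the 16677 primes `q ≤ 4 599 989` with `ord_q 2 < 2^15`},
`Lo(S) < 2^15` — read off the kernel tuple of the `R₀ ≤ 1.94` certificate with the roundings reversed.  Print: `1.936 < R₀`
[PintzRuzsa2003, (8.14)] = [KhalfalahPintz2006, Cor. 1]. [cite: PintzRuzsa2003, (8.13)–(8.14)] -/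
theorem romanovConst_ge_sharp : (193665067 : ℝ) / 10 ^ 8 ≤ romanovConst := by
  refine partialSum_ge.trans (sum_wt_div_Lo_le_romanovConst _ fun S hS => ?_)
  have hSC : S ⊆ CsetT recs := Finset.mem_powerset.1 (Finset.mem_filter.1 hS).1
  exact fun p hp => primeSet_CsetT certAll_recs' p (hSC hp)

/-- **Romanov's constant is at least `1.93665`**: the LOWER half of the printed `1.936 < R₀ < 1.94` [PintzRuzsa2003, (8.14)],
sharpened, as a kernel theorem (hypothesis-free; standard axioms). [cite: PintzRuzsa2003, (8.14)] -/
theorem romanovConst_ge_193665 : (1.93665 : ℝ) ≤ romanovConst :=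
  le_trans (by norm_num) romanovConst_ge_sharp

/-- **Both halves of the printed window are now theorems**: `1.93665 ≤ R₀ ≤ 1.94` (print: `1.936 < R₀ < 1.94`,
[PintzRuzsa2003, (8.14)] citing [KhalfalahPintz2006, Cor. 1] "by calculations"; upper half `romanovConst_le_194`,
`GoldbachLinnikRomanovCertTop`). [cite: PintzRuzsa2003, (8.14)] -/
theorem romanovConst_window : (1.93665 : ℝ) ≤ romanovConst ∧ romanovConst ≤ 1.94 :=
  ⟨romanovConst_ge_193665, romanovConst_le_194⟩

/-- **REFUTED printed bound (Platt–Trudgian 2015, p. 55; Johnston–Trudgian 2026 v2, (R0bounds))**: "`1.93642 < C₂ < 1.93656`"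
resp. "`1.93642 < R_0 < 1.93656`" — `C₂ = R_0` there is the series `Σ_d k(d)/ξ(d) = romanovConst`, and `romanovConst < 1.93656`
is FALSE since `romanovConst ≥ 1.93665`.  (Both attribute the decimal to Pintz 2006, Lemma 2″: `C₀C₂ < 1.2784421041`.)
[cite: PlattTrudgian2015Linnik, §1 p. 55] -/
theorem not_romanovConst_lt_193656 : ¬ romanovConst < 1.93656 := by
  have h := romanovConst_ge_193665
  intro hlt
  linarith

/-- **REFUTED printed bound (Lü–Sun 2009, proof of Lemma 2.4; Liu–Lü 2011, proof of Lemma 2.3)**: "By Lemma 2 of [Pintz 2006],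
we can replace (41) of [Heath-Brown–Puchta] by `C₂ ≤ 1.93657`" — FALSE for `C₂ = Σ_d k(d)/ε(d) = romanovConst ≥ 1.93665`
(Heath-Brown–Puchta's own (41), `C₂ ≤ 2.2141`, and Khalfalah–Pintz's `R₀ < 1.94` are unaffected and TRUE: `romanovConst_le_194`).
[cite: LuSun2009, Lemma 2.4 (proof)] -/
theorem not_romanovConst_le_193657 : ¬ romanovConst ≤ 1.93657 := by
  have h := romanovConst_ge_193665
  intro hle
  linarith

/-- **The twin prime constant is at least `0.660135`** (kernel certificate: the fixed-point product over the `2546` odd primes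
`≤ 22800` — candidates of a trial division complete on primes — times the tail factor `22799/22800` of
`Chen.twinPrimeConstPartial_mul_le_twinPrimeConst`).  Wrench: `C₀ = 0.6601618158…`; the tree's previous lower bound was
`twinPrimeConst_ge : 0.65828 ≤ C₀`. [cite: Nathanson1996, Thm 10.3 (proof)] -/
theorem twinPrimeConst_ge_0660135 : (0.660135 : ℝ) ≤ twinPrimeConst := by
  have hK : (12177884634887772488 : ℝ) ≤ ((TwinPrimeConstLowerCert.c0Lo 22800 : ℕ) : ℝ) := by
    have h := Nat.le_of_ble_eq_true TwinPrimeConstLowerCert.c0Lo_22800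
    exact_mod_cast h
  have hloop := TwinPrimeConstLowerCert.loop_le (22800 - 2) 3 (2 ^ 64) le_rfl
  rw [show 3 + (22800 - 2) = 22800 + 1 from rfl] at hloop
  have hpart := TwinPrimeConstLowerCert.prod_cand_le_partial 22800
  have htail := Chen.twinPrimeConstPartial_mul_le_twinPrimeConst (show 2 ≤ 22800 by norm_num)
  have hprod0 : 0 ≤ ∏ m ∈ Finset.Ico 3 (22800 + 1),
      (if TwinPrimeConstLowerCert.cand m = true then TwinPrimeConstLowerCert.fac m else 1) :=
    Finset.prod_nonneg fun m hm => by
      split_ifs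
      · exact (TwinPrimeConstLowerCert.fac_bounds (by have := (Finset.mem_Ico.1 hm).1; omega)).1
      · exact zero_le_one
  have h264 : (((2 ^ 64 : ℕ) : ℕ) : ℝ) = 2 ^ 64 := by push_cast; ring
  have hc0 : ((TwinPrimeConstLowerCert.c0Lo 22800 : ℕ) : ℝ) ≤ 2 ^ 64 * twinPrimeConstPartial 22800 := by
    unfold TwinPrimeConstLowerCert.c0Lo
    refine hloop.trans ?_
    rw [h264]
    exact mul_le_mul_of_nonneg_left hpart (by positivity)
  have htf : (0 : ℝ) ≤ ((22800 : ℕ) : ℝ) - 1 := by norm_num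
  have h1 : (12177884634887772488 : ℝ) / 2 ^ 64 * ((((22800 : ℕ) : ℝ) - 1) / ((22800 : ℕ) : ℝ)) ≤
      twinPrimeConstPartial 22800 * ((((22800 : ℕ) : ℝ) - 1) / ((22800 : ℕ) : ℝ)) := by
    refine mul_le_mul_of_nonneg_right ?_ (div_nonneg htf (by positivity))
    rw [div_le_iff₀ (by positivity)]
    linarith
  calc (0.660135 : ℝ) ≤ (12177884634887772488 : ℝ) / 2 ^ 64 * ((((22800 : ℕ) : ℝ) - 1) / ((22800 : ℕ) : ℝ)) := by
        norm_num
    _ ≤ _ := h1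
    _ ≤ twinPrimeConst := htail

/-- **REFUTED printed bound (Pintz 2006, Lemma 2″ as quoted by Platt–Trudgian 2015, p. 55)**: "`1.2783521041 < C₂C₀ < 1.2784421041`"
— the UPPER inequality is FALSE: `C₀·R₀ ≥ 0.660135 · 1.93665067 > 1.27845 > 1.2784421041` (both factors kernel-certified).
The same decimal is the input of Pintz's own threshold `C₁′ ≤ 2.603226` (reproduced exactly from `C₀R₀ = 1.2784421041` by
`pintz_Ktwo_threshold_asPrinted`, `RomanovConstantLowerBounds`) and of Johnston–Trudgian's (R0bounds).  The refereed window `0.27835 < A(1) = C₀R₀ − 1 <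
0.2792521041` [KhalfalahPintz2006, Thm 2; quoted by Languasco–Zaccagnini 2010, Lemma 1] is CONSISTENT with the kernel.
[cite: PlattTrudgian2015Linnik, §1 p. 55] -/
theorem not_twinPrimeConst_mul_romanovConst_lt : ¬ twinPrimeConst * romanovConst < 1.2784421041 := by
  have hC := twinPrimeConst_ge_0660135
  have hR := romanovConst_ge_sharp
  have h : (0.660135 : ℝ) * ((193665067 : ℝ) / 10 ^ 8) ≤ twinPrimeConst * romanovConst :=
    mul_le_mul hC hR (by norm_num) (le_trans (by norm_num) hC)
  intro hlt
  have : (0.660135 : ℝ) * ((193665067 : ℝ) / 10 ^ 8) < 1.2784421041 := lt_of_le_of_lt h hlt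
  norm_num at this

/-- **Kernel window for `C₀R₀ = 1 + A(1)`**: `1.27845 ≤ C₀R₀ ≤ 1.2808` (`0.660135 ≤ C₀ ≤ 0.660166`,
`1.93665067 ≤ R₀ ≤ 1.94`).  Print: `1.27835 < C₀R₀ < 1.2792521041` [KhalfalahPintz2006, Thm 2, `k = 1`] (consistent);
`C₀R₀ < 1.2784421041` [Pintz 2006, Lemma 2″ apud Platt–Trudgian] (refuted, `not_twinPrimeConst_mul_romanovConst_lt`).
[cite: PintzRuzsa2003, (8.14) and (8.16)] -/
theorem twinPrimeConst_mul_romanovConst_window :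
    (1.27845 : ℝ) ≤ twinPrimeConst * romanovConst ∧ twinPrimeConst * romanovConst ≤ 1.2808 := by
  have hC := twinPrimeConst_ge_0660135
  have hC' := twinPrimeConst_le_0660166
  have hR := romanovConst_ge_sharp
  have hR' := romanovConst_le_194
  have hC0 : (0 : ℝ) ≤ twinPrimeConst := le_trans (by norm_num) hC
  constructor
  · calc (1.27845 : ℝ) ≤ 0.660135 * ((193665067 : ℝ) / 10 ^ 8) := by norm_num
      _ ≤ twinPrimeConst * romanovConst := mul_le_mul hC hR (by norm_num) hC0
  · calc twinPrimeConst * romanovConst ≤ 0.660166 * 1.94 :=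
        mul_le_mul hC' hR' romanovConst_nonneg (by norm_num)
      _ ≤ 1.2808 := by norm_num

end Literature.NumberTheory.Sieve.GoldbachLinnik
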